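import Summits.CriticalPhenomena.PercolationContinuityZ3.Theorems.Transplant.GrigorchukTorsion
import Mathlib.GroupTheory.OrderOfElement
import Mathlib.Tactic.Group
import HarnessLib

/-!
# The tree's first Grigorchuk group is a 2-GROUP: every element of `𝔊 = ⟨a, b, c, d⟩ ≤ Perm({0,1}^ℕ)` has order a power of `2`

builds on p205010 (kernel theorem, internal audit signed; external expert review pending) — nothing in this file uses p205010; pure group theory, no percolation
statement, no node touched.  Group theory of `𝔊` (Grigorchuk 1980): the sharpening of «GrigorchukTorsion» p591617 (`isOfFinOrder_of_mem`) to Grigorchuk's theorem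
as stated — a 2-group.  Same induction on the pair (len, weight) of the alternating normal forms of «GrigorchukNormalForms», with the predicate 'some power `2^k`
kills `g`' in place of `IsOfFinOrder`: it passes to conjugates, from the square (`k + 1`) and — for `g ∈ St(1)` — from the two sections (`max`, `ψ` injective); the
base cases are involutions (`k = 1`).  Lane `prim-bschramm`, seat `prim-bschramm-p3` gen 35 (DESIGN OWNER; `run/shared/lean/prim/bschramm/P3-NILPOTENT.md` §28.8,
offer O11).  Helper file (`--supports stmt-CriticalPhenomena-4575 --as helper`).  Def-free.  NOTHING about growth or amenability; nothing about the end state.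
* `Grigorchuk.exists_pow_two_pow_eq_one (hg : g ∈ grigorchukGroup) : ∃ k, g ^ 2 ^ k = 1`, `Grigorchuk.orderOf_dvd_two_pow`.
[cite: Grigorchuk1980, Theorem: the group is an infinite 2-group] [cite: BartholdiErschler2012, §3.1 (the first Grigorchuk group, citing Grigorchuk)]
-/

noncomputable section

namespace Summit.CriticalPhenomena.PercolationContinuityZ3.Theorems.Transplant

namespace Grigorchuk

/-! ## §1 The predicate 'killed by a power of 2' -/

/-- `a² = 1` (local copy). [cite: Grigorchuk1980, a is an involution] -/
private theorem genA_sq'' : genA * genA = 1 := Equiv.ext fun x => flipAt_involutive 0 x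

/-- Killed by a power of two passes to conjugates. [folklore] -/
theorem twoPow_conj {g h : Equiv.Perm Ray} (hg : ∃ k : ℕ, g ^ 2 ^ k = 1) : ∃ k : ℕ, (h * g * h⁻¹) ^ 2 ^ k = 1 := by
  obtain ⟨k, hk⟩ := hg
  exact ⟨k, by rw [conj_pow, hk, mul_one, mul_inv_cancel]⟩

/-- Killed by a power of two passes from the square. [folklore] -/
theorem twoPow_of_sq {g : Equiv.Perm Ray} (hg : ∃ k : ℕ, (g * g) ^ 2 ^ k = 1) : ∃ k : ℕ, g ^ 2 ^ k = 1 := by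
  obtain ⟨k, hk⟩ := hg
  exact ⟨k + 1, by rw [pow_succ', pow_mul, pow_two, hk]⟩

/-- For `g ∈ St(1)`: if both sections are killed by powers of two, so is `g`. [cite: BartholdiErschler2012, §3.1 (ψ injective)] -/
theorem twoPow_of_sec (g : ↥stabOne) (h0 : ∃ k : ℕ, sec false g ^ 2 ^ k = 1) (h1 : ∃ k : ℕ, sec true g ^ 2 ^ k = 1) :
    ∃ k : ℕ, (g : Equiv.Perm Ray) ^ 2 ^ k = 1 := by
  obtain ⟨m, hm⟩ := h0
  obtain ⟨n, hn⟩ := h1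
  refine ⟨m + n, ?_⟩
  have hpow : g ^ 2 ^ (m + n) = 1 := by
    refine eq_of_sec_eq ?_ ?_
    · rw [map_pow, map_one, pow_add, pow_mul, hm, one_pow]
    · rw [map_pow, map_one, pow_add, mul_comm, pow_mul, hn, one_pow]
  rw [← Subgroup.coe_pow, hpow, Subgroup.coe_one]

/-- An involution is killed by `2 = 2^1`. [folklore] -/
theorem twoPow_of_involutive {g : Equiv.Perm Ray} (hg : g * g = 1) : ∃ k : ℕ, g ^ 2 ^ k = 1 := ⟨1, by rw [pow_one, pow_two, hg]⟩

/-! ## §2 The induction (as in «GrigorchukTorsion», with the sharper predicate) -/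

/-- **MAIN STEP (2-power form).** [cite: Grigorchuk1980, proof of the torsion theorem] -/
theorem main_step_twoPow (n w : ℕ) (ihn : ∀ N : NForm, N.len < n → ∃ k : ℕ, N.eval ^ 2 ^ k = 1)
    (ihw : ∀ N : NForm, N.len ≤ n → N.weight < w → ∃ k : ℕ, N.eval ^ 2 ^ k = 1)
    (L : List BCD) (hn : 2 * L.length ≤ n) (hw : (L.map fun x => x.toV4.wt).sum ≤ w) : ∃ k : ℕ, blocks L ^ 2 ^ k = 1 := by
  rcases Nat.even_or_odd L.length with ⟨k, hk⟩ | ⟨k, hk⟩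
  · have hL : L.length = 2 * k := by omega
    have hmem := blocks_mem_stabOne k L hL
    by_cases h0 : L.length = 0
    · rw [List.length_eq_zero_iff.1 h0, blocks_nil]; exact ⟨0, one_pow _⟩
    refine twoPow_of_sec ⟨blocks L, hmem⟩ ?_ ?_
    · rw [sec_blocks k L hL hmem, ← eval_nf]
      exact ihn _ (lt_of_le_of_lt (len_nf_le _) (by have := length_psw_le L false; omega))
    · rw [sec_blocks k L hL hmem, ← eval_nf]
      exact ihn _ (lt_of_le_of_lt (len_nf_le _) (by have := length_psw_le L true; omega))
  · have hL : L.length = 2 * k + 1 := hk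
    have hmem : blocks (L ++ L) ∈ stabOne := blocks_mem_stabOne (2 * k + 1) (L ++ L) (by rw [List.length_append]; omega)
    refine twoPow_of_sq ?_
    rw [← blocks_append]
    have hsec : ∀ s : Bool, (sec s ⟨blocks (L ++ L), hmem⟩ : Equiv.Perm Ray) = ((psw s L ++ psw (!s) L).map Letter.toPerm).prod := by
      intro s
      rw [sec_blocks (2 * k + 1) (L ++ L) (by rw [List.length_append]; omega) hmem, psw_append]
      congr 3
      rw [hL]; cases s <;> simp
    have hw2 : ∀ u v : List Letter, wordWeight (u ++ v) = wordWeight u + wordWeight v := fun u v => by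
      simp [wordWeight, List.map_append, List.sum_append]
    have hc0 := length_psw_add L false
    have hc1 := length_psw_add L true
    have hw0 := wordWeight_psw_add L false
    have hw1 := wordWeight_psw_add L true
    simp only [Bool.not_false, Bool.not_true] at hc0 hc1 hw0 hw1
    have hpos : 0 < L.length := by omega
    refine twoPow_of_sec ⟨blocks (L ++ L), hmem⟩ ?_ ?_ <;> rw [hsec, ← eval_nf] <;>
      simp only [Bool.not_false, Bool.not_true]
    all_goals
      by_cases hd : 0 < L.count BCD.d
      · refine ihn _ (lt_of_le_of_lt (len_nf_le _) ?_)
        rw [List.length_append]; omega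
      · have hd0 : L.count BCD.d = 0 := by omega
        refine ihw _ ((len_nf_le _).trans ?_) (lt_of_le_of_lt (weight_nf_le _) ?_)
        · rw [List.length_append]; omega
        · rw [hw2]; omega

/-- **THE INDUCTION (2-power form)**: every normal form is killed by a power of `2`. [cite: Grigorchuk1980, proof of the torsion theorem] -/
theorem twoPow_eval : ∀ (n w : ℕ) (N : NForm), N.len ≤ n → N.weight ≤ w → ∃ k : ℕ, N.eval ^ 2 ^ k = 1 := by
  intro n
  induction n using Nat.strong_induction_on with
  | _ n ihn =>
    intro w
    induction w using Nat.strong_induction_on with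
    | _ w ihw =>
      intro N hn hw
      have IHn : ∀ N' : NForm, N'.len < n → ∃ k : ℕ, N'.eval ^ 2 ^ k = 1 := fun N' h => ihn N'.len h N'.weight N' le_rfl le_rfl
      have IHw : ∀ N' : NForm, N'.len ≤ n → N'.weight < w → ∃ k : ℕ, N'.eval ^ 2 ^ k = 1 := fun N' h h' => ihw N'.weight h' N' h le_rfl
      rcases N with ⟨p, L, q⟩
      have hlen : (⟨p, L, q⟩ : NForm).len = (if p then 1 else 0) + 2 * L.length + (if q = .e then 0 else 1) := rfl
      have hwt : (⟨p, L, q⟩ : NForm).weight = (L.map fun x => x.toV4.wt).sum + q.wt := rfl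
      have hq : q = .e ∨ ∃ y : BCD, y.toV4 = q := by
        rcases q with _ | _ | _ | _
        · exact Or.inl rfl
        · exact Or.inr ⟨.b, rfl⟩
        · exact Or.inr ⟨.c, rfl⟩
        · exact Or.inr ⟨.d, rfl⟩
      rcases hq with rfl | ⟨y, rfl⟩ <;> cases p
      · rw [eval_main]
        exact main_step_twoPow n w IHn IHw L (by simp [hlen] at hn; omega) (by simpa [hwt, V4.wt] using hw)
      · by_cases hL0 : L = []
        · subst hL0
          have : (⟨true, [], V4.e⟩ : NForm).eval = genA := by simp [NForm.eval]
          rw [this]; exact twoPow_of_involutive genA_sq''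
        · obtain ⟨M, x, rfl⟩ := exists_eq_append_singleton L hL0
          have e : (⟨true, M ++ [x], V4.e⟩ : NForm).eval = genA * (⟨false, M, x.toV4⟩ : NForm).eval * genA⁻¹ := by
            rw [show genA⁻¹ = genA from inv_eq_of_mul_eq_one_right genA_sq'']
            simp only [NForm.eval, if_true, Bool.false_eq_true, if_false, one_mul, V4.toPerm_e, mul_one, blocks_append, blocks_cons,
              blocks_nil, BCD.toPerm]
            group
          rw [e]
          refine twoPow_conj (IHn _ ?_)
          have h1 : (⟨false, M, x.toV4⟩ : NForm).len = 2 * M.length + 1 := by cases x <;> simp [NForm.len, BCD.toV4]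
          have h2 : (⟨true, M ++ [x], V4.e⟩ : NForm).len = 2 * M.length + 3 := by
            simp [NForm.len, List.length_append]; omega
          rw [h1]; rw [h2] at hn; omega
      · rcases L with _ | ⟨x₁, L'⟩
        · have : (⟨false, [], y.toV4⟩ : NForm).eval = y.toPerm := by simp [NForm.eval, BCD.toPerm]
          rw [this]
          refine twoPow_of_involutive ?_
          rw [BCD.toPerm, ← V4.toPerm_mul]; cases y <;> rfl
        · have e : (⟨false, x₁ :: L', y.toV4⟩ : NForm).eval =
              y.toPerm⁻¹ * ((V4.mul y.toV4 x₁.toV4).toPerm * genA * blocks L') * y.toPerm⁻¹⁻¹ := by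
            rw [inv_inv, V4.toPerm_mul, ← BCD.toPerm]
            simp only [NForm.eval, Bool.false_eq_true, if_false, one_mul, blocks_cons, BCD.toPerm]
            rw [show (y.toV4.toPerm)⁻¹ = y.toV4.toPerm from inv_eq_of_mul_eq_one_right (by rw [← V4.toPerm_mul]; cases y <;> rfl)]
            have hy2 : y.toV4.toPerm * y.toV4.toPerm = 1 := by rw [← V4.toPerm_mul]; cases y <;> rfl
            calc x₁.toV4.toPerm * genA * blocks L' * y.toV4.toPerm
                = (y.toV4.toPerm * y.toV4.toPerm) * (x₁.toV4.toPerm * genA * blocks L' * y.toV4.toPerm) := by rw [hy2, one_mul]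
              _ = _ := by group
          rw [e]
          refine twoPow_conj ?_
          have hn' : 2 * L'.length + 3 ≤ n := by cases y <;> simp [NForm.len, BCD.toV4] at hn <;> omega
          rcases hm : V4.mul y.toV4 x₁.toV4 with _ | _ | _ | _
          · have : (V4.e.toPerm * genA * blocks L') = (⟨true, L', V4.e⟩ : NForm).eval := by simp [NForm.eval]
            rw [this]; refine IHn _ ?_; simp [NForm.len]; omega
          · have : (V4.b.toPerm * genA * blocks L') = blocks (.b :: L') := by simp [blocks_cons, BCD.toPerm, BCD.toV4]
            rw [this, ← eval_main]; refine IHn _ ?_; simp [NForm.len]; omega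
          · have : (V4.c.toPerm * genA * blocks L') = blocks (.c :: L') := by simp [blocks_cons, BCD.toPerm, BCD.toV4]
            rw [this, ← eval_main]; refine IHn _ ?_; simp [NForm.len]; omega
          · have : (V4.d.toPerm * genA * blocks L') = blocks (.d :: L') := by simp [blocks_cons, BCD.toPerm, BCD.toV4]
            rw [this, ← eval_main]; refine IHn _ ?_; simp [NForm.len]; omega
      · have e : (⟨true, L, y.toV4⟩ : NForm).eval = genA * blocks (L ++ [y]) * genA⁻¹ := by
          rw [show genA⁻¹ = genA from inv_eq_of_mul_eq_one_right genA_sq'']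
          simp only [NForm.eval, if_true, blocks_append, blocks_cons, blocks_nil, mul_one, BCD.toPerm]
          rw [show genA * (blocks L * (y.toV4.toPerm * genA)) * genA = genA * blocks L * y.toV4.toPerm * (genA * genA) by group, genA_sq'', mul_one]
        rw [e]
        refine twoPow_conj (main_step_twoPow n w IHn IHw (L ++ [y]) ?_ ?_)
        · simp [hlen] at hn; rw [List.length_append, List.length_singleton]; cases y <;> simp [BCD.toV4] at hn <;> omega
        · simpa [hwt, List.map_append, List.sum_append] using hw

/-! ## §3 The 2-group theorem -/

/-- **THE FIRST GRIGORCHUK GROUP IS A 2-GROUP (for the tree's `𝔊`)**: every element of `𝔊` is killed by a power of `2`. [cite: Grigorchuk1980, Theorem: the group is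
an infinite 2-group] -/
theorem exists_pow_two_pow_eq_one {g : Equiv.Perm Ray} (hg : g ∈ grigorchukGroup) : ∃ k : ℕ, g ^ 2 ^ k = 1 := by
  obtain ⟨N, rfl⟩ := exists_nform_of_mem hg
  exact twoPow_eval N.len N.weight N le_rfl le_rfl

/-- **The order of every element of `𝔊` divides a power of `2`.** [cite: Grigorchuk1980, Theorem: the group is an infinite 2-group] -/
theorem orderOf_dvd_two_pow {g : Equiv.Perm Ray} (hg : g ∈ grigorchukGroup) : ∃ k : ℕ, orderOf g ∣ 2 ^ k := by
  obtain ⟨k, hk⟩ := exists_pow_two_pow_eq_one hg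
  exact ⟨k, orderOf_dvd_of_pow_eq_one hk⟩

end Grigorchuk

end Summit.CriticalPhenomena.PercolationContinuityZ3.Theorems.Transplant

end
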